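import Summits.QuantumFields.YangMills.Theses.SmallCircleAnchor
import Literature.MathematicalPhysics.QuantumLattice.LatticeGaugeDLRProofs
import Summits.QuantumFields.QCD.Theorems.NestedDissectionSeaRobustYangMillsRGStubGaugeAveragingAux

/-!
# Gauge averaging (Osterwalder–Seiler) on link fields — abstract toolkit

Helpers for crux stmt-QuantumFields-11141 (`AnchorGap`, route `SmallCircleAnchor`): the toolkit
behind the reduction of volume-uniform clustering of ALL bounded local observables of the pinned
finite-temperature Wilson theory to the clustering of GAUGE-INVARIANT ones
(`SmallCircleAnchorAnchorGapElitzurReduction`). Stated over an arbitrary finite site type `St`,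
direction type `D`, shift map `sh : St → D → St` and a gauge action `gauge` characterised by
`gauge h U (x, μ) = h x · U (x, μ) · (h (sh x μ))⁻¹` (a free function symbol plus this
hypothesis, so that no definition is introduced):

* (reused from the QCD toolkit) `pi_integral_mul_of_dependsOn`, `pi_integral_comp_equiv` —
  independence of disjoint coordinate blocks and relabelling invariance of product measures;
* `measurePreserving_gauge`, `integral_comp_gauge` — product Haar is gauge invariant;
* the Haar average `U ↦ ∫ F (gauge h U) dh` over ALL gauge transformations: measurable, bounded,
  gauge invariant, same link support, same expectation under a gauge-invariant weight
  (`integral_haarAvg_mul`), and the factorisation of the average of `F₁ · (F₂ ∘ σ)` for a link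
  relabelling `σ` induced by a site bijection commuting with `sh` when the gauge supports are
  disjoint (`haarAvg_mul_comp`);
* `soft_haar_gauge_invariant` — the instance for the crux's inline vocabulary (registered
  sub-goal): product Haar on `(ℤ_T × (ℤ/L)³) × Option (Fin 3) → G` is invariant under every
  lattice gauge transformation.

Pattern adapted from the tree's
`Summits/QuantumFields/QCD/Theorems/NestedDissectionSeaRobustYangMillsRGStubGaugeAveragingAux.lean`.
Reference: K. Osterwalder, E. Seiler, Ann. Phys. 110 (1978) 440, §2.
-/

set_option autoImplicit false

noncomputable section

namespace Summit.QuantumFields.YangMills.Theorems.AnchorGap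

open MeasureTheory
open Literature.MathematicalPhysics.QuantumFieldTheory

namespace GaugeAvg

/-! ### Product probability measures

Independence of disjoint coordinate blocks (`pi_integral_mul_of_dependsOn`) and relabelling
invariance (`pi_integral_comp_equiv`) of product probability measures are reused from the tree's
QCD gauge-averaging toolkit (namespace
`Summit.QuantumFields.QCD.Cruxes.RobustYangMillsRG.Birth.GaugeAveraging`). -/

open Summit.QuantumFields.QCD.Cruxes.RobustYangMillsRG.Birth.GaugeAveraging
  (pi_integral_mul_of_dependsOn pi_integral_comp_equiv)

/-! ### Gauge transformations on `St × D`-indexed link fields -/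

section Gauge

variable {St D : Type*} {G : Type*} [Group G]
variable (sh : St → D → St)
variable (gauge : (St → G) → (St × D → G) → (St × D → G))
variable (hgauge : ∀ (h : St → G) (U : St × D → G) (p : St × D),
  gauge h U p = h p.1 * U p * (h (sh p.1 p.2))⁻¹)

include hgauge

/-- Composition of gauge transformations: `h • (h₀ • U) = (h h₀) • U`. [folklore] -/
theorem gauge_mul (h h₀ : St → G) (U : St × D → G) :
    gauge h (gauge h₀ U) = gauge (h * h₀) U := by
  funext p
  simp only [hgauge, Pi.mul_apply, mul_inv_rev, mul_assoc]

/-- The trivial gauge transformation acts as the identity. [folklore] -/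
theorem gauge_one (U : St × D → G) : gauge 1 U = U := by
  funext p
  simp only [hgauge, Pi.one_apply, one_mul, inv_one, mul_one]

/-- Locality in the configuration: if `F` depends only on the links in `S`, so does `F (h • ·)`.
[folklore] -/
theorem dependsOn_gauge_right {β : Type*} {S : Set (St × D)} {F : (St × D → G) → β}
    (hF : DependsOn F S) (h : St → G) : DependsOn (fun U => F (gauge h U)) S := by
  intro U U' hUU'
  exact hF fun p hp => by simp only [hgauge, hUU' p hp]

/-- Locality in the gauge field: if `F` depends only on the links in `S` and `A` contains both
endpoints `p.1`, `sh p.1 p.2` of every link `p ∈ S`, then `h ↦ F (h • U)` depends only on `h|_A`.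
[folklore] -/
theorem dependsOn_gauge_left {β : Type*} {S : Set (St × D)} {A : Set St} {F : (St × D → G) → β}
    (hF : DependsOn F S) (hA : ∀ p ∈ S, p.1 ∈ A ∧ sh p.1 p.2 ∈ A) (U : St × D → G) :
    DependsOn (fun h : St → G => F (gauge h U)) A := by
  intro h h' hhh'
  exact hF fun p hp => by simp only [hgauge, hhh' _ (hA p hp).1, hhh' _ (hA p hp).2]

/-- **Relabellings commuting with the shift intertwine gauge transformations**: if `τ : St → St`
satisfies `τ (sh x μ) = sh (τ x) μ`, then relabelling the links by `τ` after gauging by `h` is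
gauging by `h ∘ τ` after relabelling. [folklore] -/
theorem comp_gauge_of_comm (τ : St → St) (hτ : ∀ x μ, τ (sh x μ) = sh (τ x) μ) (h : St → G)
    (U : St × D → G) :
    (fun p : St × D => gauge h U (τ p.1, p.2)) = gauge (h ∘ τ) (fun p => U (τ p.1, p.2)) := by
  funext p
  simp only [hgauge, Function.comp_apply, hτ]

/-- Joint continuity of the gauge action `(h, U) ↦ h • U`. [folklore] -/
theorem continuous_gauge₂ [TopologicalSpace G] [IsTopologicalGroup G] :
    Continuous fun q : (St → G) × (St × D → G) => gauge q.1 q.2 := by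
  refine continuous_pi fun p => ?_
  have : (fun q : (St → G) × (St × D → G) => gauge q.1 q.2 p) =
      fun q => q.1 p.1 * q.2 p * (q.1 (sh p.1 p.2))⁻¹ := funext fun q => hgauge q.1 q.2 p
  rw [this]
  exact (((continuous_apply p.1).comp continuous_fst).mul
    ((continuous_apply p).comp continuous_snd)).mul
      (((continuous_apply (sh p.1 p.2)).comp continuous_fst).inv)

/-- The joint gauge action is measurable (second countability of `G`). [folklore] -/
theorem measurable_gauge₂ [TopologicalSpace G] [IsTopologicalGroup G] [SecondCountableTopology G]
    [MeasurableSpace G] [BorelSpace G] [Countable St] [Countable D] :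
    Measurable fun q : (St → G) × (St × D → G) => gauge q.1 q.2 :=
  (continuous_gauge₂ sh gauge hgauge).measurable

/-- For a fixed configuration, `h ↦ h • U` is measurable. [folklore] -/
theorem measurable_gauge_left [TopologicalSpace G] [IsTopologicalGroup G] [SecondCountableTopology G]
    [MeasurableSpace G] [BorelSpace G] [Countable St] [Countable D] (U : St × D → G) :
    Measurable fun h : St → G => gauge h U :=
  (measurable_gauge₂ sh gauge hgauge).comp (measurable_id.prodMk measurable_const)

/-- For a fixed gauge field, `U ↦ h • U` is measurable. [folklore] -/
theorem measurable_gauge_right [TopologicalSpace G] [IsTopologicalGroup G] [SecondCountableTopology G]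
    [MeasurableSpace G] [BorelSpace G] [Countable St] [Countable D] (h : St → G) :
    Measurable fun U : St × D → G => gauge h U :=
  (measurable_gauge₂ sh gauge hgauge).comp (measurable_const.prodMk measurable_id)

/-- **Product Haar is gauge invariant**: `U ↦ h • U` preserves `Haar^{⊗ links}` (each link is
moved by `g ↦ a g b⁻¹`, which preserves the Haar probability measure of the compact group `G`).
[folklore] -/
theorem measurePreserving_gauge [TopologicalSpace G] [IsTopologicalGroup G] [CompactSpace G]
    [MeasurableSpace G] [BorelSpace G] [Fintype St] [Fintype D] (h : St → G) :
    MeasurePreserving (gauge h) (Measure.pi fun _ : St × D => haarProbability G)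
      (Measure.pi fun _ : St × D => haarProbability G) := by
  have := measurePreserving_pi (f := fun (p : St × D) (x : G) => h p.1 * x * (h (sh p.1 p.2))⁻¹)
    (fun _ : St × D => haarProbability G) (fun _ : St × D => haarProbability G)
    (fun p => Literature.MathematicalPhysics.QuantumLattice.measurePreserving_mul_mul_inv_haarProbability
      (h p.1) (h (sh p.1 p.2)))
  convert this using 1
  funext U; funext p; exact hgauge h U p

/-- Change of variables `U ↦ h • U` in an integral against product Haar, for a measurable
integrand. [folklore] -/
theorem integral_comp_gauge [TopologicalSpace G] [IsTopologicalGroup G] [CompactSpace G]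
    [MeasurableSpace G] [BorelSpace G] [Fintype St] [Fintype D]
    (h : St → G) {Φ : (St × D → G) → ℝ} (hΦ : Measurable Φ) :
    ∫ U, Φ (gauge h U) ∂Measure.pi (fun _ : St × D => haarProbability G) =
      ∫ U, Φ U ∂Measure.pi (fun _ : St × D => haarProbability G) := by
  have hmp := measurePreserving_gauge sh gauge hgauge h
  rw [← integral_map hmp.measurable.aemeasurable hΦ.aestronglyMeasurable, hmp.map_eq]

/-! ### The Haar average over all gauge transformations -/

/-- **The Haar average `U ↦ ∫ F (h • U) dh` is measurable.** [folklore] -/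
theorem measurable_haarAvg [TopologicalSpace G] [IsTopologicalGroup G] [CompactSpace G]
    [SecondCountableTopology G] [MeasurableSpace G] [BorelSpace G] [Fintype St] [Countable St]
    [Countable D] {F : (St × D → G) → ℝ} (hF : Measurable F) :
    Measurable fun U : St × D → G =>
      ∫ h, F (gauge h U) ∂Measure.pi fun _ : St => haarProbability G := by
  have hsm : StronglyMeasurable fun q : (St → G) × (St × D → G) => F (gauge q.1 q.2) :=
    (hF.comp (measurable_gauge₂ sh gauge hgauge)).stronglyMeasurable
  exact (hsm.integral_prod_left' (μ := Measure.pi fun _ : St => haarProbability G)).measurable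

omit hgauge in
/-- The Haar average inherits the bound `|F| ≤ C`. [folklore] -/
theorem abs_haarAvg_le [TopologicalSpace G] [IsTopologicalGroup G] [CompactSpace G]
    [MeasurableSpace G] [BorelSpace G] [Fintype St]
    {F : (St × D → G) → ℝ} {C : ℝ} (hC : ∀ U, |F U| ≤ C) (U : St × D → G) :
    |∫ h, F (gauge h U) ∂Measure.pi fun _ : St => haarProbability G| ≤ C := by
  have := norm_integral_le_of_norm_le_const (μ := Measure.pi fun _ : St => haarProbability G)
    (f := fun h : St → G => F (gauge h U)) (C := C)
    (ae_of_all _ fun h => by simpa only [Real.norm_eq_abs] using hC (gauge h U))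
  simpa [Real.norm_eq_abs, probReal_univ] using this

omit hgauge in
/-- Right translations preserve the product Haar measure on gauge fields. [folklore] -/
theorem measurePreserving_mul_right_pi [TopologicalSpace G] [IsTopologicalGroup G] [CompactSpace G]
    [MeasurableSpace G] [BorelSpace G] [Fintype St] (h₀ : St → G) :
    MeasurePreserving (fun h : St → G => h * h₀)
      (Measure.pi fun _ : St => haarProbability G) (Measure.pi fun _ : St => haarProbability G) := by
  have := measurePreserving_pi (f := fun (x : St) (g : G) => 1 * g * (h₀ x)⁻¹⁻¹)
    (fun _ : St => haarProbability G) (fun _ : St => haarProbability G)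
    (fun x => Literature.MathematicalPhysics.QuantumLattice.measurePreserving_mul_mul_inv_haarProbability
      (1 : G) (h₀ x)⁻¹)
  convert this using 1
  funext h; funext x; simp [Pi.mul_apply]

/-- **The Haar average is gauge invariant**: `∫ F (h • (h₀ • U)) dh = ∫ F (h • U) dh`.
[folklore] -/
theorem haarAvg_gauge [TopologicalSpace G] [IsTopologicalGroup G] [CompactSpace G]
    [MeasurableSpace G] [BorelSpace G] [Fintype St]
    (F : (St × D → G) → ℝ) (h₀ : St → G) (U : St × D → G) :
    ∫ h, F (gauge h (gauge h₀ U)) ∂Measure.pi (fun _ : St => haarProbability G)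
      = ∫ h, F (gauge h U) ∂Measure.pi fun _ : St => haarProbability G := by
  simp only [gauge_mul sh gauge hgauge]
  have hmp : MeasurePreserving (MeasurableEquiv.mulRight h₀)
      (Measure.pi fun _ : St => haarProbability G) (Measure.pi fun _ : St => haarProbability G) := by
    rw [MeasurableEquiv.coe_mulRight]
    exact measurePreserving_mul_right_pi (G := G) h₀
  simpa [MeasurableEquiv.coe_mulRight] using hmp.integral_comp' (fun h => F (gauge h U))

/-- The Haar average has the same link support as `F`. [folklore] -/
theorem dependsOn_haarAvg [MeasurableSpace G] {S : Set (St × D)} {F : (St × D → G) → ℝ}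
    (hF : DependsOn F S) (π : Measure (St → G)) :
    DependsOn (fun U : St × D → G => ∫ h, F (gauge h U) ∂π) S := by
  intro U U' hUU'
  dsimp only
  congr 1
  funext h
  exact dependsOn_gauge_right sh gauge hgauge hF h hUU'

/-- **The Haar average has the same expectation under a gauge-invariant weight**: for bounded
measurable `F` and an integrable measurable gauge-invariant `wgt`,
`∫ F̄ · wgt dU = ∫ F · wgt dU` (Fubini and the change of variables `U ↦ h • U`, pointwise in `h`).
[folklore] -/
theorem integral_haarAvg_mul [TopologicalSpace G] [IsTopologicalGroup G] [CompactSpace G]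
    [SecondCountableTopology G] [MeasurableSpace G] [BorelSpace G] [Fintype St] [Fintype D]
    {wgt : (St × D → G) → ℝ}
    (hwm : Measurable wgt) (hwi : Integrable wgt (Measure.pi fun _ : St × D => haarProbability G))
    (hw : ∀ h U, wgt (gauge h U) = wgt U)
    {F : (St × D → G) → ℝ} (hF : Measurable F) {C : ℝ} (hC : ∀ U, |F U| ≤ C) :
    ∫ U, (∫ h, F (gauge h U) ∂Measure.pi (fun _ : St => haarProbability G)) * wgt U
        ∂Measure.pi (fun _ : St × D => haarProbability G)
      = ∫ U, F U * wgt U ∂Measure.pi fun _ : St × D => haarProbability G := by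
  set μ : Measure (St × D → G) := Measure.pi fun _ : St × D => haarProbability G with hμ
  set π : Measure (St → G) := Measure.pi fun _ : St => haarProbability G with hπ
  haveI : IsProbabilityMeasure π := by rw [hπ]; infer_instance
  have hA : ∀ h : St → G, ∫ U, F (gauge h U) * wgt U ∂μ = ∫ U, F U * wgt U ∂μ := by
    intro h
    have h1 : (fun U => F (gauge h U) * wgt U) = fun U => (fun U' => F U' * wgt U') (gauge h U) := by
      funext U; simp only [hw]
    rw [h1]
    exact integral_comp_gauge sh gauge hgauge h (hF.mul hwm)
  have hint : Integrable (Function.uncurry fun (U : St × D → G) (h : St → G) =>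
      F (gauge h U) * wgt U) (μ.prod π) := by
    refine Integrable.mono' ((hwi.norm.const_mul C).comp_fst π) ?_ (ae_of_all _ ?_)
    · exact ((hF.comp ((measurable_gauge₂ sh gauge hgauge).comp
        (measurable_snd.prodMk measurable_fst))).mul (hwm.comp measurable_fst)).aestronglyMeasurable
    · rintro ⟨U, h⟩
      simp only [Function.uncurry_apply_pair, norm_mul, Real.norm_eq_abs]
      exact mul_le_mul_of_nonneg_right (hC _) (abs_nonneg _)
  calc ∫ U, (∫ h, F (gauge h U) ∂π) * wgt U ∂μ
      = ∫ U, ∫ h, F (gauge h U) * wgt U ∂π ∂μ := by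
        congr 1; funext U; exact (integral_mul_const (wgt U) _).symm
    _ = ∫ h, ∫ U, F (gauge h U) * wgt U ∂μ ∂π := integral_integral_swap hint
    _ = ∫ U, F U * wgt U ∂μ := by simp only [hA, integral_const, probReal_univ, one_smul]

/-- **Factorisation of the joint Haar average for disjoint gauge supports.** Let `τ : St ≃ St`
commute with the shift and let `σ U := U ∘ (τ × id)` be the induced relabelling of links. If
`h ↦ F₁ (h • U)` depends only on `h|_A` and `F₂` depends on links whose endpoints lie in a set `B`
with `τ '' B ⊆ Aᶜ`... concretely: `F₁` is supported on links `S₁` with endpoints in `A`, `F₂` on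
links `S₂` with endpoints in `B`, and `τ x ∉ A` for `x ∈ B`. Then
`∫ F₁ (h • U) · F₂ (σ (h • U)) dh = (∫ F₁ (h • U) dh) · (∫ F₂ (h • σ U) dh)`. [folklore] -/
theorem haarAvg_mul_comp [TopologicalSpace G] [IsTopologicalGroup G] [CompactSpace G]
    [SecondCountableTopology G] [MeasurableSpace G] [BorelSpace G] [Fintype St] [Fintype D]
    (τ : St ≃ St)
    (hτ : ∀ x μ, τ (sh x μ) = sh (τ x) μ)
    {S₁ S₂ : Set (St × D)} {A B : Set St}
    (hA : ∀ p ∈ S₁, p.1 ∈ A ∧ sh p.1 p.2 ∈ A) (hB : ∀ p ∈ S₂, p.1 ∈ B ∧ sh p.1 p.2 ∈ B)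
    (hdisj : ∀ x ∈ B, τ x ∉ A)
    {F₁ F₂ : (St × D → G) → ℝ} (hF₁ : Measurable F₁) (hF₂ : Measurable F₂)
    (hd₁ : DependsOn F₁ S₁) (hd₂ : DependsOn F₂ S₂) (U : St × D → G) :
    ∫ h, F₁ (gauge h U) * F₂ (fun p => gauge h U (τ p.1, p.2))
        ∂Measure.pi (fun _ : St => haarProbability G)
      = (∫ h, F₁ (gauge h U) ∂Measure.pi (fun _ : St => haarProbability G)) *
        ∫ h, F₂ (gauge h (fun p => U (τ p.1, p.2))) ∂Measure.pi fun _ : St => haarProbability G := by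
  simp only [comp_gauge_of_comm sh gauge hgauge τ hτ]
  have hΦ₁ : DependsOn (fun h : St → G => F₁ (gauge h U)) A :=
    dependsOn_gauge_left sh gauge hgauge hd₁ hA U
  have hΦ₂ : DependsOn (fun h : St → G => F₂ (gauge (h ∘ τ) (fun p => U (τ p.1, p.2)))) Aᶜ := by
    intro h h' hhh'
    refine dependsOn_gauge_left sh gauge hgauge hd₂ hB (fun p => U (τ p.1, p.2)) fun x hx => ?_
    exact hhh' (τ x) (hdisj x hx)
  have hm₁ : Measurable fun h : St → G => F₁ (gauge h U) :=
    hF₁.comp (measurable_gauge_left sh gauge hgauge U)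
  have hmσ : Measurable fun h : St → G => h ∘ τ :=
    measurable_pi_lambda _ fun x => measurable_pi_apply (τ x)
  have hm₂ : Measurable fun h : St → G => F₂ (gauge (h ∘ τ) (fun p => U (τ p.1, p.2))) :=
    hF₂.comp ((measurable_gauge_left sh gauge hgauge _).comp hmσ)
  rw [pi_integral_mul_of_dependsOn (haarProbability G) 1 A hm₁ hm₂ hΦ₁ hΦ₂]
  congr 1
  exact pi_integral_comp_equiv (haarProbability G) τ
    (fun h => F₂ (gauge h (fun p => U (τ p.1, p.2))))

end Gauge

/-! ### Instance for the crux vocabulary -/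

/-- **Product Haar on the finite-temperature lattice is gauge invariant** (crux `AnchorGap`
vocabulary): for every `h : ℤ_T × (ℤ/L)³ → G`, the gauge transformation
`(h • U)(x, μ) = h x · U(x, μ) · (h (x + e_μ))⁻¹` preserves `ν = Haar^{⊗ links}`. [folklore] -/
theorem soft_haar_gauge_invariant :
    ∀ (G : Type) [Group G] [TopologicalSpace G] [IsTopologicalGroup G] [CompactSpace G], letI : MeasurableSpace G := borel G; haveI : BorelSpace G := ⟨rfl⟩; ∀ (T : ℕ) [NeZero T] (L : ℕ) [NeZero L], let St := ZMod T × (Fin 3 → ZMod L); let Cfg := St × Option (Fin 3) → G; let ν : MeasureTheory.Measure Cfg := MeasureTheory.Measure.pi fun _ => haarProbability G; let sh : St → Option (Fin 3) → St := fun x μ => Option.elim μ (x.1 + 1, x.2) fun i => (x.1, x.2 + Pi.single i 1); let gauge : (St → G) → Cfg → Cfg := fun h U p => h p.1 * U p * (h (sh p.1 p.2))⁻¹; ∀ h : St → G, MeasureTheory.MeasurePreserving (gauge h) ν ν := by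
  intro G _ _ _ _
  letI : MeasurableSpace G := borel G
  haveI : BorelSpace G := ⟨rfl⟩
  intro T _ L _ St Cfg ν sh gauge h
  exact measurePreserving_gauge sh gauge (fun _ _ _ => rfl) h

end GaugeAvg

end Summit.QuantumFields.YangMills.Theorems.AnchorGap

end
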